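/-
Copyright: lit-balaban READER/TYPER seat r18 (gen 11).  Statement-level skeleton of a published paper; no proof claims beyond what
the kernel checks below.
-/
import Literature.MathematicalPhysics.QuantumFieldTheory.BalabanImbrieJaffe1984to88.BIJ88Normalization46
import Literature.MathematicalPhysics.QuantumFieldTheory.BalabanImbrieJaffe1984to88.BIJ88Eq240Existence

/-!
# `BalabanImbrieJaffe1984to88.BIJ88Normalization49Of238` — T. Bałaban, J. Imbrie, A. Jaffe, *Effective action and cluster properties of
the abelian Higgs model*, Commun. Math. Phys. **114** (1988) 257–315 [BalabanImbrieJaffe1988], (4.9)–(4.11) p. 275 [PDF 19] with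
(2.38)–(2.40) p. 264 [PDF 8]: **the scalar normalization factor `Z^{(j)}_{Λ₁₀}(u_k)` of (4.9) AT A GENERAL STEP is a convergent, positive
Gaussian integral with the closed form of r18 gen 2's `BIJ88Normalization46.Z49_eq`, WHENEVER the quadratic form
`Δ^{L^jη}_{j,loc}(u_k) + aL^{−2}P(u_k)` is bounded below as on p. 264** — *"By (2.38), Δ_{k,loc}(u) + aL^{−2}Q(u)*Q(u) is bounded below"* —
i.e. under EXACTLY the hypotheses of seat p02's (2.40) existence theorem `BIJ88Eq240Existence.eq240_of_238` ((2.38)-shape lower bound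
`h238`, the Poincaré-type input `hP` of [I] §7, `c·e_k²p(e_k)² < c₁`), plus the symmetry of `Δ` that (4.9) presupposes.  The SAME positivity
that makes `C^{(k)}_Λ(u)` of (2.40) exist makes (4.9) converge: the two rows are one fact.

statement-level skeleton of published theorems with citation tags; proofs where landed; nothing here is a claim about the Yang–Mills mass gap

PDF held: `paper:balaban1988-cmp114-bij-abelian-higgs-effective-action` (journal page = PDF page + 256); p. 275 [PDF 19] (render
`HOME/lit-balaban-r18/renders/c2-p019.png`, r18 gen 5) and p. 264 [PDF 8] (text layer) re-read for this file.

CITATION HEADER (lean-in-tree rule).  Part of the lit-balaban TYPED SKELETON (HOME `run/shared/lean/pub/lit-balaban/`), READER/TYPER seat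
r18 = the C2 §§1–4 fold owner (unit `lit-balaban-r18`, gen 11).  Row served: **C2.Eq4.9** of `HOME/lit-balaban-r18/ROWS-C2.md` (DEF row; decl of
record `BIJ88Normalization46.Z49`, closed form `Z49_eq` under `T.PosDef` (r18 gen 2, p244232); FIRST-STEP torus instance hypothesis-free
`BIJ88Normalization49Torus` (r18 gen 7, p258330: at `j = 0` the form is (3.31), positive by [I] (4.6.2)); the cell's scope note *"j ≥ 1 needs
the (2.38)/(2.40) positivity of Δ_{j,loc}"* is what this file supplies, at the real-matrix level of p02's (2.40) file).  Cross-reference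
rows C2.Eq2.38 / C2.Eq2.40 (p02 gen 3, p248488 / p249610).  Decls used BY NAME (nothing restated): r18's `Z49`/`Z49_eq`/`Z49_pos`/`log_Z49`/
`log_Z49_sites`, p02's `lowerBound_of_238`/`pos_of_lowerBound`/`form_add_smul_adj`, `BIJ88Sect4Statements.Eks` ((4.11)).

THE PRINTED TEXT.  p. 275 (4.9): *"Z^{(j)}_{Λ₁₀^{(j)}}(u_k) = ∫𝒟φ_{Λ₁₀^{(j)}} exp(−½⟨Λ₁₀^{(j)}φ,(Δ^{L^jη}_{j,loc}(u_k) + aL^{−2}P(u_k))Λ₁₀^{(j)}φ⟩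
− E^{(j)}_{k,s}|Λ₁₀^{(j)}|), where P(u_k) = Q(u_k)*Q(u_k) (4.10) and E^{(j)}_{k,s} = −(d−2)log L^jη. (4.11)"*; p. 264: *"C^{(k)}_Λ(Ω,u) =
[(Δ_k(Ω,u) + aL^{−2}Q(u)*Q(u))|_Λ]^{−1}, (2.39) … C^{(k)}_Λ(u) = [(Δ_{k,loc}(u) + aL^{−2}Q(u)*Q(u))|_Λ]^{−1}. (2.40) … By (2.38), Δ_{k,loc}(u) +
aL^{−2}Q(u)*Q(u) is bounded below"*.

THE READING (kind «hence-step at the model level of p02's (2.40) file»; nothing new).  As in `BIJ88Normalization46`/`BIJ88Normalization49Torus`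
the complex field `φ` on `Λ₁₀` is written in real coordinates (index type `n`, `|n| = 2|Λ₁₀|` for the (4.11) substitution) and the
operator `(Δ_{j,loc}(u_k) + aL^{−2}Q(u_k)*Q(u_k))|_{Λ₁₀}` is a real matrix `Δ + (aL^{−2})·(Q^*Q)` with `Q^*` the `⬝ᵥ`-adjoint of `Q`
(p02's `hadj`), `Δ` symmetric (the kernels of (2.34) are Hermitian: `G_{k,loc}` is a symmetrized Neumann propagator, (2.27)–(2.29)).  Under
p02's hypotheses `h238` ((2.38) as a quadratic-form bound with the covariant-difference form `A`), `hP` (`c₁‖φ‖² ≤ cA(φ) + aL^{−2}‖Qφ‖²`, the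
Poincaré-type input of [I] §7 that p. 264 invokes silently) and `hsmall` (`c·e_k²p(e_k)² < c₁`, small `e_k`), p02's `lowerBound_of_238`
gives `(c₁ − ce_k²p_k²)‖φ‖² ≤ ⟨φ,(Δ + aL^{−2}Q^*Q)φ⟩`, hence the matrix is positive definite and r18's `Z49_eq`/`Z49_pos`/`log_Z49`/
`log_Z49_sites` apply.

WHAT IS PROVED (kernel-checked; theorems only; 0 `sorry`; no `def`, no named fact; standard axioms):
* §1 `posDef_of_isSymm_of_pos` (a symmetric real matrix with strictly positive quadratic form is `PosDef`), `isSymm_op240` (the (2.40)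
  operator is symmetric when `Δ` is and `Q^*` is the adjoint of `Q`), **`posDef_op240_of_238`** (p02's hypotheses + `Δ.IsSymm` ⟹ `PosDef`).
* §2 **`Z49_eq_of_238`** (the closed form of (4.9) at a general step: `Z = e^{−EN}·√(2π)^{|n|}/√det`), `Z49_pos_of_238`, `log_Z49_of_238`,
  **`log_Z49_sites_of_238`** ((4.11) substituted, `|n| = 2|Λ₁₀|`).
HONEST SCOPE.  (i) Real-matrix model level, exactly as p02's (2.40) file: the torus instances of `Δ_{j,loc}(u_k)`, `Q_j(u_k)` for `j ≥ 1`
(built from the localized Neumann propagators `G_{j,loc}` of (2.27)–(2.29)) are NOT constructed in the tree, so the hypotheses `h238`/`hP` are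
displayed, not discharged; at `j = 0` everything is discharged (`BIJ88Normalization49Torus`).  (ii) `Λ₁₀`-restriction = the index type `n`
(Dirichlet: fields supported in `Λ₁₀`).  (iii) How `Δ_{j,loc}(u_k)` and `aL^{−2}P(u_k)` individually scale with the step is not addressed here
(rows C2.Eq4.9/4.11 carry r18 gen 9's `BIJ88Eq411Scaling` for the homogeneity of the total precision).  NOT summit progress.  Unit
`lit-balaban-r18` (literature-prover-lit-balaban-r18-g11-0), 2026-08-22.
-/

namespace Literature.MathematicalPhysics.QuantumFieldTheory.BalabanImbrieJaffe1984to88.BIJ88Normalization49Of238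

open Matrix
open BIJ88Normalization46 (Z49 Z49_eq Z49_pos log_Z49 log_Z49_sites)
open BIJ88Eq240Existence (lowerBound_of_238 pos_of_lowerBound)

noncomputable section

variable {n : Type*} [Fintype n] [DecidableEq n]

/-! ## §1  Positivity of the (2.40)/(4.9) operator from the (2.38)-shape lower bound -/

omit [DecidableEq n] in
/-- A symmetric real matrix whose quadratic form is strictly positive off `0` is positive definite. [cite: BalabanImbrieJaffe1988, (2.40) p.264] -/
theorem posDef_of_isSymm_of_pos {M : Matrix n n ℝ} (hsym : M.IsSymm) (hpos : ∀ φ : n → ℝ, φ ≠ 0 → 0 < φ ⬝ᵥ (M *ᵥ φ)) :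
    M.PosDef := by
  refine Matrix.posDef_iff_dotProduct_mulVec.2 ⟨?_, fun v hv => ?_⟩
  · rw [Matrix.IsHermitian, Matrix.conjTranspose_eq_transpose_of_trivial]
    exact hsym
  · rw [star_trivial]
    exact hpos v hv

/-- **the (2.40) operator `Δ + aL^{−2}Q^*Q` is symmetric** when `Δ` is symmetric and `Q^*` is the `⬝ᵥ`-adjoint of `Q`.
[cite: BalabanImbrieJaffe1988, (2.40) p.264] -/
theorem isSymm_op240 {a L : ℝ} {Δ Qst Q : Matrix n n ℝ} (hΔ : Δ.IsSymm)
    (hadj : ∀ φ ψ : n → ℝ, φ ⬝ᵥ (Qst *ᵥ ψ) = (Q *ᵥ φ) ⬝ᵥ ψ) :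
    (Δ + algebraMap ℝ (Matrix n n ℝ) (a * L ^ (-(2 : ℤ))) * (Qst * Q)).IsSymm := by
  -- `Qst = Qᵀ` entrywise from the adjoint identity on basis vectors
  have hQst : Qst = Qᵀ := by
    ext i j
    have h := hadj (Pi.single i 1) (Pi.single j 1)
    simpa [Matrix.mulVec, dotProduct, Pi.single_apply, Matrix.transpose_apply, Finset.sum_ite_eq, Finset.sum_ite_eq',
      Finset.mem_univ] using h
  have hQQ : (Qst * Q).IsSymm := by
    rw [hQst]
    exact Matrix.isSymm_transpose_mul_self Q
  have hsmul : (algebraMap ℝ (Matrix n n ℝ) (a * L ^ (-(2 : ℤ))) * (Qst * Q)).IsSymm := by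
    rw [Algebra.algebraMap_eq_smul_one, smul_mul_assoc, one_mul]
    exact hQQ.smul _
  exact hΔ.add hsmul

/-- **`Δ_{k,loc}(u) + aL^{−2}Q(u)^*Q(u)` IS POSITIVE DEFINITE under the p. 264 lower bound** — p02's hypotheses of `eq240_of_238` (the
(2.38)-shape bound `h238`, the Poincaré-type input `hP`, `c·e_k²p(e_k)² < c₁`) plus `Δ.IsSymm`: the quadratic form is `≥ (c₁ − ce_k²p_k²)‖φ‖²`
(p02's `lowerBound_of_238`), hence `PosDef`. [cite: BalabanImbrieJaffe1988, (2.40) p.264] -/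
theorem posDef_op240_of_238 {a L c c₁ ek pek : ℝ} {Δ Qst Q : Matrix n n ℝ} {A : (n → ℝ) → ℝ} (hΔ : Δ.IsSymm)
    (hadj : ∀ φ ψ : n → ℝ, φ ⬝ᵥ (Qst *ᵥ ψ) = (Q *ᵥ φ) ⬝ᵥ ψ)
    (h238 : ∀ φ, c * A φ - c * ek ^ 2 * pek ^ 2 * (φ ⬝ᵥ φ) ≤ φ ⬝ᵥ (Δ *ᵥ φ))
    (hP : ∀ φ, c₁ * (φ ⬝ᵥ φ) ≤ c * A φ + a * L ^ (-(2 : ℤ)) * ((Q *ᵥ φ) ⬝ᵥ (Q *ᵥ φ))) (hsmall : c * ek ^ 2 * pek ^ 2 < c₁) :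
    (Δ + algebraMap ℝ (Matrix n n ℝ) (a * L ^ (-(2 : ℤ))) * (Qst * Q)).PosDef :=
  posDef_of_isSymm_of_pos (isSymm_op240 hΔ hadj)
    (pos_of_lowerBound (sub_pos.2 hsmall) (lowerBound_of_238 hadj h238 hP))

/-! ## §2  (4.9) at a general step: closed form, positivity, logarithm, (4.11) substituted -/

/-- **(4.9) AT A GENERAL STEP, EVALUATED**: under the p. 264 lower bound (p02's hypotheses + `Δ.IsSymm`), the scalar normalization factor with
precision `T = Δ_{j,loc}(u_k) + aL^{−2}Q(u_k)^*Q(u_k)` (real coordinates `n` on `Λ₁₀`) is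
`Z^{(j)}_{Λ₁₀}(u_k) = e^{−E|Λ₁₀|}·√(2π)^{|n|}/√(det T)` — r18 gen 2's `Z49_eq` with `T.PosDef` discharged by §1.
[cite: BalabanImbrieJaffe1988, (4.9) p.275] -/
theorem Z49_eq_of_238 {a L c c₁ ek pek : ℝ} {Δ Qst Q : Matrix n n ℝ} {A : (n → ℝ) → ℝ} (hΔ : Δ.IsSymm)
    (hadj : ∀ φ ψ : n → ℝ, φ ⬝ᵥ (Qst *ᵥ ψ) = (Q *ᵥ φ) ⬝ᵥ ψ)
    (h238 : ∀ φ, c * A φ - c * ek ^ 2 * pek ^ 2 * (φ ⬝ᵥ φ) ≤ φ ⬝ᵥ (Δ *ᵥ φ))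
    (hP : ∀ φ, c₁ * (φ ⬝ᵥ φ) ≤ c * A φ + a * L ^ (-(2 : ℤ)) * ((Q *ᵥ φ) ⬝ᵥ (Q *ᵥ φ))) (hsmall : c * ek ^ 2 * pek ^ 2 < c₁)
    (E N : ℝ) :
    Z49 (Δ + algebraMap ℝ (Matrix n n ℝ) (a * L ^ (-(2 : ℤ))) * (Qst * Q)) E N =
      Real.exp (-(E * N)) * (Real.sqrt (2 * Real.pi) ^ Fintype.card n /
        Real.sqrt (Δ + algebraMap ℝ (Matrix n n ℝ) (a * L ^ (-(2 : ℤ))) * (Qst * Q)).det) :=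
  Z49_eq _ (posDef_op240_of_238 hΔ hadj h238 hP hsmall) E N

/-- (4.9) at a general step is a positive number under the p. 264 lower bound. [cite: BalabanImbrieJaffe1988, (4.9) p.275] -/
theorem Z49_pos_of_238 {a L c c₁ ek pek : ℝ} {Δ Qst Q : Matrix n n ℝ} {A : (n → ℝ) → ℝ} (hΔ : Δ.IsSymm)
    (hadj : ∀ φ ψ : n → ℝ, φ ⬝ᵥ (Qst *ᵥ ψ) = (Q *ᵥ φ) ⬝ᵥ ψ)
    (h238 : ∀ φ, c * A φ - c * ek ^ 2 * pek ^ 2 * (φ ⬝ᵥ φ) ≤ φ ⬝ᵥ (Δ *ᵥ φ))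
    (hP : ∀ φ, c₁ * (φ ⬝ᵥ φ) ≤ c * A φ + a * L ^ (-(2 : ℤ)) * ((Q *ᵥ φ) ⬝ᵥ (Q *ᵥ φ))) (hsmall : c * ek ^ 2 * pek ^ 2 < c₁)
    (E N : ℝ) :
    0 < Z49 (Δ + algebraMap ℝ (Matrix n n ℝ) (a * L ^ (-(2 : ℤ))) * (Qst * Q)) E N :=
  Z49_pos _ (posDef_op240_of_238 hΔ hadj h238 hP hsmall) E N

/-- **(4.9) at a general step in logarithmic form**: `log Z = −E·N + (|n|/2) log 2π − ½ log det T` under the p. 264 lower bound.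
[cite: BalabanImbrieJaffe1988, (4.9) p.275] -/
theorem log_Z49_of_238 {a L c c₁ ek pek : ℝ} {Δ Qst Q : Matrix n n ℝ} {A : (n → ℝ) → ℝ} (hΔ : Δ.IsSymm)
    (hadj : ∀ φ ψ : n → ℝ, φ ⬝ᵥ (Qst *ᵥ ψ) = (Q *ᵥ φ) ⬝ᵥ ψ)
    (h238 : ∀ φ, c * A φ - c * ek ^ 2 * pek ^ 2 * (φ ⬝ᵥ φ) ≤ φ ⬝ᵥ (Δ *ᵥ φ))
    (hP : ∀ φ, c₁ * (φ ⬝ᵥ φ) ≤ c * A φ + a * L ^ (-(2 : ℤ)) * ((Q *ᵥ φ) ⬝ᵥ (Q *ᵥ φ))) (hsmall : c * ek ^ 2 * pek ^ 2 < c₁)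
    (E N : ℝ) :
    Real.log (Z49 (Δ + algebraMap ℝ (Matrix n n ℝ) (a * L ^ (-(2 : ℤ))) * (Qst * Q)) E N) =
      -(E * N) + (Fintype.card n : ℝ) / 2 * Real.log (2 * Real.pi)
        - (1 / 2 : ℝ) * Real.log (Δ + algebraMap ℝ (Matrix n n ℝ) (a * L ^ (-(2 : ℤ))) * (Qst * Q)).det :=
  log_Z49 _ (posDef_op240_of_238 hΔ hadj h238 hP hsmall) E N

/-- **(4.9) at a general step with its printed constant (4.11) substituted** (`E = E^{(j)}_{k,s} = −(d−2) log L^jη`, `N = |Λ₁₀|`, `|n| = 2|Λ₁₀|`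
real coordinates): `log Z^{(j)}_{Λ₁₀}(u_k) = |Λ₁₀|·((d−2) log L^jη + log 2π) − ½ log det T`, under the p. 264 lower bound.
[cite: BalabanImbrieJaffe1988, (4.11) p.275] -/
theorem log_Z49_sites_of_238 {a L c c₁ ek pek : ℝ} {Δ Qst Q : Matrix n n ℝ} {A : (n → ℝ) → ℝ} (hΔ : Δ.IsSymm)
    (hadj : ∀ φ ψ : n → ℝ, φ ⬝ᵥ (Qst *ᵥ ψ) = (Q *ᵥ φ) ⬝ᵥ ψ)
    (h238 : ∀ φ, c * A φ - c * ek ^ 2 * pek ^ 2 * (φ ⬝ᵥ φ) ≤ φ ⬝ᵥ (Δ *ᵥ φ))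
    (hP : ∀ φ, c₁ * (φ ⬝ᵥ φ) ≤ c * A φ + a * L ^ (-(2 : ℤ)) * ((Q *ᵥ φ) ⬝ᵥ (Q *ᵥ φ))) (hsmall : c * ek ^ 2 * pek ^ 2 < c₁)
    (d nΛ : ℕ) (Ljη : ℝ) (hn : Fintype.card n = 2 * nΛ) :
    Real.log (Z49 (Δ + algebraMap ℝ (Matrix n n ℝ) (a * L ^ (-(2 : ℤ))) * (Qst * Q)) (BIJ88Sect4Statements.Eks d Ljη) nΛ) =
      (nΛ : ℝ) * (((d : ℝ) - 2) * Real.log Ljη + Real.log (2 * Real.pi))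
        - (1 / 2 : ℝ) * Real.log (Δ + algebraMap ℝ (Matrix n n ℝ) (a * L ^ (-(2 : ℤ))) * (Qst * Q)).det :=
  log_Z49_sites _ (posDef_op240_of_238 hΔ hadj h238 hP hsmall) d nΛ Ljη hn

end

end Literature.MathematicalPhysics.QuantumFieldTheory.BalabanImbrieJaffe1984to88.BIJ88Normalization49Of238
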